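import Mathlib
import HarnessLib
import Literature.MathematicalPhysics.QuantumManyBody.GroundStateFeynmanKacSpectral

/-!
# RiemannHypothesis / de Branges–Suzuki door — tail witness, file 1/4: spectral facts for ONE compact
self-adjoint operator (RH-FREE, ζ-FREE)

Cell rh-split, target T12 / spectral step L1 `TailGivesShiftWitness` (card `cards/SPLIT-dbr-neg.md` §10; lead g2
coordination note 21:40Z: the statement of record is the hypothesis `hL1` / `hstep` of the LANDED
`Theorems/DeBrangesSuzukiDoorShiftWitness.lean`, p467879).  This file: for a compact self-adjoint `A` on a real
Hilbert space,
* `exists_eigenvector_norm_or_neg` — `A ≠ 0` has an eigenvector for `‖A‖` or `−‖A‖` (norm attainment on `A ∘ A` via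
  the tree lemma `Literature.MathematicalPhysics.QuantumManyBody.BoseGas.exists_eigenvector_norm_of_isCompactOperator`);
* `finite_eigenvalues_abs_ge` — only finitely many eigenvalues have modulus `≥ c > 0`;
* the «big space» `⨆_{1 ≤ |μ|, μ eigenvalue} ker(A − μ)` is finite-dimensional, `A`-invariant with `A`-invariant
  orthogonal complement, carries every eigenvector of modulus `≥ 1`, and `A` is a STRICT contraction on its
  orthogonal complement (`exists_contraction_orthogonal`).
Zero definitions (the big set / big space are written out in every statement).  Filed by rh-split-typer-2 g2 as
support of route DeBrangesSuzukiDoor's residual `DoorWitness` (stmt-RiemannHypothesis-19728).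
RH-free operator theory; nothing here bears on the truth of RH.
-/

set_option linter.dupNamespace false

noncomputable section

open scoped InnerProductSpace
open Filter Topology Module Module.End

namespace Summit.RiemannHypothesis.RiemannHypothesis.Theorems.SuzukiDoorTailWitness

variable {E : Type*} [NormedAddCommGroup E] [InnerProductSpace ℝ E] [CompleteSpace E]

/-! ## 1. A non-zero compact self-adjoint operator has an eigenvector for `‖A‖` or `−‖A‖` -/

omit [CompleteSpace E] in
/-- Unit vectors almost attaining the operator norm: `‖A‖² − ε < ‖A u‖²`. -/
theorem exists_unit_sq_gt (A : E →L[ℝ] E) (hA : A ≠ 0) {ε : ℝ} (hε : 0 < ε) :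
    ∃ u : E, ‖u‖ = 1 ∧ ‖A‖ ^ 2 - ε < ‖A u‖ ^ 2 := by
  have hr : 0 < ‖A‖ := norm_pos_iff.2 hA
  -- radius r' = ‖A‖ - ε/(2‖A‖) (or ‖A‖/2 if that is larger), with r'^2 > ‖A‖^2 - ε and r' < ‖A‖
  set r' : ℝ := max (‖A‖ / 2) (‖A‖ - ε / (2 * ‖A‖)) with hr'
  have hr'lt : r' < ‖A‖ := by
    rw [hr', max_lt_iff]; constructor
    · linarith
    · have : 0 < ε / (2 * ‖A‖) := by positivity
      linarith
  have hr'pos : 0 < r' := lt_of_lt_of_le (by linarith) (le_max_left _ _)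
  have hr'sq : ‖A‖ ^ 2 - ε < r' ^ 2 := by
    have h1 : ‖A‖ - ε / (2 * ‖A‖) ≤ r' := le_max_right _ _
    by_cases hcase : 0 ≤ ‖A‖ - ε / (2 * ‖A‖)
    · have h2 : (‖A‖ - ε / (2 * ‖A‖)) ^ 2 ≤ r' ^ 2 := by
        exact pow_le_pow_left₀ hcase h1 2
      have h3 : ‖A‖ ^ 2 - ε < (‖A‖ - ε / (2 * ‖A‖)) ^ 2 := by
        have hexp : (‖A‖ - ε / (2 * ‖A‖)) ^ 2 = ‖A‖ ^ 2 - ε + (ε / (2 * ‖A‖)) ^ 2 := by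
          field_simp; ring
        rw [hexp]
        have : 0 < (ε / (2 * ‖A‖)) ^ 2 := by positivity
        linarith
      linarith
    · push Not at hcase
      -- then ε > 2‖A‖², so ‖A‖² - ε < 0 < r'^2
      have : ‖A‖ ^ 2 - ε < 0 := by
        have h4 : ‖A‖ < ε / (2 * ‖A‖) := by linarith
        have h5 : ‖A‖ * (2 * ‖A‖) < ε := by
          rwa [lt_div_iff₀ (by positivity)] at h4
        nlinarith
      have : 0 < r' ^ 2 := by positivity
      linarith
  obtain ⟨x, hx1, hrx⟩ := A.exists_lt_apply_of_lt_opNorm hr'lt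
  have hAx : 0 < ‖A x‖ := hr'pos.trans hrx
  have hx0 : x ≠ 0 := by
    intro h; rw [h, map_zero, norm_zero] at hAx; exact lt_irrefl _ hAx
  have hxn : 0 < ‖x‖ := norm_pos_iff.2 hx0
  refine ⟨(‖x‖⁻¹ : ℝ) • x, norm_smul_inv_norm hx0, ?_⟩
  have hAu : ‖A ((‖x‖⁻¹ : ℝ) • x)‖ = ‖x‖⁻¹ * ‖A x‖ := by
    rw [map_smul, norm_smul, Real.norm_eq_abs, abs_of_pos (inv_pos.2 hxn)]
  have hge1 : ‖A x‖ ≤ ‖x‖⁻¹ * ‖A x‖ := by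
    have : 1 ≤ ‖x‖⁻¹ := (one_le_inv₀ hxn).2 hx1.le
    nlinarith
  have h1 : r' < ‖x‖⁻¹ * ‖A x‖ := hrx.trans_le hge1
  rw [hAu]
  nlinarith

/-- **Norm attainment with sign.** A non-zero compact self-adjoint operator on a real Hilbert space has an
eigenvector with eigenvalue `‖A‖` or `−‖A‖` (top eigenvector of `A ∘ A` via the tree lemma
`exists_eigenvector_norm_of_isCompactOperator`, then `v = ‖A‖ e + A e` or `e`). -/
theorem exists_eigenvector_norm_or_neg (A : E →L[ℝ] E) (hsa : IsSelfAdjoint A)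
    (hk : IsCompactOperator A) (hA : A ≠ 0) :
    ∃ v : E, v ≠ 0 ∧ (A v = ‖A‖ • v ∨ A v = (-‖A‖) • v) := by
  have hr : 0 < ‖A‖ := norm_pos_iff.2 hA
  have hsym : (A : E →ₗ[ℝ] E).IsSymmetric := hsa.isSymmetric
  set S : E →L[ℝ] E := A.comp A with hS
  have hSapp : ∀ x : E, S x = A (A x) := fun x => rfl
  have hinner : ∀ x : E, ⟪S x, x⟫_ℝ = ‖A x‖ ^ 2 := by
    intro x
    rw [hSapp, ← real_inner_self_eq_norm_sq]
    exact hsym (A x) x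
  have hSk : IsCompactOperator S := hk.comp_clm A
  have hSle : ‖S‖ ≤ ‖A‖ ^ 2 := by
    calc ‖S‖ ≤ ‖A‖ * ‖A‖ := A.opNorm_comp_le A
      _ = ‖A‖ ^ 2 := by ring
  have hSge : ‖A‖ ^ 2 ≤ ‖S‖ := by
    by_contra hlt
    push Not at hlt
    obtain ⟨u, hu, hAu⟩ := exists_unit_sq_gt A hA (sub_pos.2 hlt)
    have := Literature.MathematicalPhysics.QuantumManyBody.BoseGas.rayleigh_le_opNorm S hu
    rw [hinner] at this
    linarith
  have hSnorm : ‖S‖ = ‖A‖ ^ 2 := le_antisymm hSle hSge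
  have hSne : S ≠ 0 := by
    intro h; rw [h, norm_zero] at hSnorm
    have : 0 < ‖A‖ ^ 2 := by positivity
    linarith
  have happ : ∀ ε > 0, ∃ x ∈ (Set.univ : Set E), ‖x‖ = 1 ∧ ‖S‖ - ε < ⟪S x, x⟫_ℝ := by
    intro ε hε
    obtain ⟨u, hu, hAu⟩ := exists_unit_sq_gt A hA hε
    exact ⟨u, Set.mem_univ _, hu, by rw [hinner, hSnorm]; exact hAu⟩
  obtain ⟨e, -, he1, hSe⟩ :=
    Literature.MathematicalPhysics.QuantumManyBody.BoseGas.exists_eigenvector_norm_of_isCompactOperator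
      S hSk hSne isClosed_univ happ
  rw [hSnorm, hSapp] at hSe
  have hne : e ≠ 0 := by
    intro h; rw [h, norm_zero] at he1; exact zero_ne_one he1
  by_cases h : ‖A‖ • e + A e = 0
  · refine ⟨e, hne, Or.inr ?_⟩
    have : A e = -(‖A‖ • e) := eq_neg_of_add_eq_zero_right h
    rw [this, neg_smul]
  · refine ⟨‖A‖ • e + A e, h, Or.inl ?_⟩
    rw [map_add, map_smul, hSe, smul_add, smul_smul, ← sq, add_comm]

/-! ## 2. Only finitely many eigenvalues of modulus `≥ c > 0` -/

/-- The eigenvalues `μ` with `c ≤ |μ|` (`c > 0`) of a compact self-adjoint operator form a finite set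
(orthonormal eigenvectors `e_n` with `‖A e_n − A e_m‖² = μ_n² + μ_m² ≥ 2c²` admit no convergent subsequence). -/
theorem finite_eigenvalues_abs_ge (A : E →L[ℝ] E) (hsa : IsSelfAdjoint A) (hk : IsCompactOperator A)
    {c : ℝ} (hc : 0 < c) :
    Set.Finite {μ : ℝ | c ≤ |μ| ∧ HasEigenvalue (A : E →ₗ[ℝ] E) μ} := by
  by_contra hinf
  set s : Set ℝ := {μ : ℝ | c ≤ |μ| ∧ HasEigenvalue (A : E →ₗ[ℝ] E) μ} with hs
  have hsinf : s.Infinite := hinf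
  let μ : ℕ ↪ s := hsinf.natEmbedding
  -- unit eigenvectors
  have hev : ∀ n : ℕ, ∃ e : E, ‖e‖ = 1 ∧ A e = ((μ n : ℝ)) • e := by
    intro n
    obtain ⟨v, hv⟩ := ((μ n).2.2).exists_hasEigenvector
    have hv0 : v ≠ 0 := hv.2
    have hAv : A v = ((μ n : ℝ)) • v := mem_eigenspace_iff.1 hv.1
    refine ⟨(‖v‖⁻¹ : ℝ) • v, norm_smul_inv_norm hv0, ?_⟩
    rw [map_smul, hAv, smul_comm]
  choose e he1 hAe using hev
  have hsym : (A : E →ₗ[ℝ] E).IsSymmetric := hsa.isSymmetric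
  -- orthogonality of eigenvectors for distinct eigenvalues
  have horth : ∀ n m : ℕ, n ≠ m → ⟪e n, e m⟫_ℝ = 0 := by
    intro n m hnm
    have hμ : (μ n : ℝ) ≠ (μ m : ℝ) := by
      intro h
      exact hnm (μ.injective (Subtype.ext h))
    have h1 : ⟪A (e n), e m⟫_ℝ = ⟪e n, A (e m)⟫_ℝ := hsym (e n) (e m)
    rw [hAe n, hAe m, real_inner_smul_left, real_inner_smul_right] at h1
    have : ((μ n : ℝ) - (μ m : ℝ)) * ⟪e n, e m⟫_ℝ = 0 := by rw [sub_mul, h1, sub_self]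
    rcases mul_eq_zero.1 this with h | h
    · exact absurd (sub_eq_zero.1 h) hμ
    · exact h
  -- distances between images
  have hdist : ∀ n m : ℕ, n ≠ m → 2 * c ^ 2 ≤ ‖A (e n) - A (e m)‖ ^ 2 := by
    intro n m hnm
    rw [hAe n, hAe m, ← real_inner_self_eq_norm_sq]
    have h0 := horth n m hnm
    have h0' : ⟪e m, e n⟫_ℝ = 0 := by rw [real_inner_comm]; exact h0
    have hn1 : ⟪e n, e n⟫_ℝ = 1 := by rw [real_inner_self_eq_norm_sq, he1 n]; norm_num
    have hm1 : ⟪e m, e m⟫_ℝ = 1 := by rw [real_inner_self_eq_norm_sq, he1 m]; norm_num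
    simp only [inner_sub_left, inner_sub_right, real_inner_smul_left, real_inner_smul_right, h0, h0',
      hn1, hm1, mul_zero, mul_one, sub_zero, zero_sub]
    have hcn : c ^ 2 ≤ (μ n : ℝ) ^ 2 := by
      have := (μ n).2.1
      calc c ^ 2 ≤ |(μ n : ℝ)| ^ 2 := pow_le_pow_left₀ hc.le this 2
        _ = (μ n : ℝ) ^ 2 := sq_abs _
    have hcm : c ^ 2 ≤ (μ m : ℝ) ^ 2 := by
      have := (μ m).2.1
      calc c ^ 2 ≤ |(μ m : ℝ)| ^ 2 := pow_le_pow_left₀ hc.le this 2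
        _ = (μ m : ℝ) ^ 2 := sq_abs _
    nlinarith
  -- compactness of A: the images of the unit eigenvectors lie in a compact set
  obtain ⟨K, hK, hAK⟩ := hk.image_closedBall_subset_compact (𝕜₁ := ℝ) 1
  have hmem : ∀ n : ℕ, A (e n) ∈ K := fun n =>
    hAK ⟨e n, by rw [Metric.mem_closedBall, dist_zero_right, he1 n], rfl⟩
  obtain ⟨a, -, φ, hφ, hlim⟩ := hK.tendsto_subseq hmem
  have hC : ∀ᶠ n in atTop, ‖(fun n => A (e n)) (φ n) - a‖ < c / 2 := by
    have := (tendsto_iff_norm_sub_tendsto_zero.1 hlim)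
    exact (this.eventually (gt_mem_nhds (by positivity : (0 : ℝ) < c / 2)))
  obtain ⟨N, hN⟩ := hC.exists_forall_of_atTop
  have h1 := hN N le_rfl
  have h2 := hN (N + 1) (Nat.le_succ N)
  beta_reduce at h1 h2
  have hne : φ N ≠ φ (N + 1) := fun h => absurd (hφ.injective h) (Nat.succ_ne_self N).symm
  have hge := hdist (φ N) (φ (N + 1)) hne
  have hlt : ‖A (e (φ N)) - A (e (φ (N + 1)))‖ < c := by
    calc ‖A (e (φ N)) - A (e (φ (N + 1)))‖
        = ‖(A (e (φ N)) - a) - (A (e (φ (N + 1))) - a)‖ := by congr 1; abel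
      _ ≤ ‖A (e (φ N)) - a‖ + ‖A (e (φ (N + 1))) - a‖ := norm_sub_le _ _
      _ < c / 2 + c / 2 := add_lt_add h1 h2
      _ = c := by ring
  have : ‖A (e (φ N)) - A (e (φ (N + 1)))‖ ^ 2 < c ^ 2 := by
    exact pow_lt_pow_left₀ hlt (norm_nonneg _) two_ne_zero
  nlinarith

/-! ## 3. The spectral subspace of the eigenvalues of modulus `≥ 1` -/

/-! Throughout, the «big set» of `A` is `{μ : ℝ | 1 ≤ |μ| ∧ HasEigenvalue A μ}` and the «big space» is the
supremum of the corresponding eigenspaces `⨆_{μ ∈ big set} ker (A − μ)`; both are written out in every statement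
(this file declares no definitions). -/

variable {A : E →L[ℝ] E}

/-- `(⨆ μ : ↥{μ : ℝ | 1 ≤ |μ| ∧ HasEigenvalue ((A : E →L[ℝ] E) : E →ₗ[ℝ] E) μ}, eigenspace ((A : E →L[ℝ] E) : E →ₗ[ℝ] E) (μ : ℝ))` is finite-dimensional for a compact self-adjoint `A`. -/
theorem finiteDimensional_bigSpace (hsa : IsSelfAdjoint A) (hk : IsCompactOperator A) :
    FiniteDimensional ℝ ↥(⨆ μ : ↥{μ : ℝ | 1 ≤ |μ| ∧ HasEigenvalue ((A : E →L[ℝ] E) : E →ₗ[ℝ] E) μ}, eigenspace ((A : E →L[ℝ] E) : E →ₗ[ℝ] E) (μ : ℝ)) := by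
  haveI : Finite ↥{μ : ℝ | 1 ≤ |μ| ∧ HasEigenvalue ((A : E →L[ℝ] E) : E →ₗ[ℝ] E) μ} := (finite_eigenvalues_abs_ge A hsa hk one_pos).to_subtype
  haveI : ∀ μ : ↥{μ : ℝ | 1 ≤ |μ| ∧ HasEigenvalue ((A : E →L[ℝ] E) : E →ₗ[ℝ] E) μ}, FiniteDimensional ℝ (eigenspace (A : E →ₗ[ℝ] E) (μ : ℝ)) := by
    intro μ
    have hμ0 : (μ : ℝ) ≠ 0 := by
      intro h
      have := μ.2.1
      rw [h, abs_zero] at this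
      exact absurd this (by norm_num)
    exact ContinuousLinearMap.finite_dimensional_eigenspace hk (μ : ℝ) hμ0
  exact Submodule.finiteDimensional_iSup _

omit [CompleteSpace E] in
/-- An eigenvector with eigenvalue of modulus `≥ 1` lies in `(⨆ μ : ↥{μ : ℝ | 1 ≤ |μ| ∧ HasEigenvalue ((A : E →L[ℝ] E) : E →ₗ[ℝ] E) μ}, eigenspace ((A : E →L[ℝ] E) : E →ₗ[ℝ] E) (μ : ℝ))`. -/
theorem mem_bigSpace_of_eigen {v : E} {μ : ℝ} (hv : A v = μ • v) (hμ : 1 ≤ |μ|) :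
    v ∈ (⨆ μ : ↥{μ : ℝ | 1 ≤ |μ| ∧ HasEigenvalue ((A : E →L[ℝ] E) : E →ₗ[ℝ] E) μ}, eigenspace ((A : E →L[ℝ] E) : E →ₗ[ℝ] E) (μ : ℝ)) := by
  by_cases hv0 : v = 0
  · rw [hv0]; exact Submodule.zero_mem _
  have hmem : v ∈ eigenspace (A : E →ₗ[ℝ] E) μ := mem_eigenspace_iff.2 hv
  have hμ' : HasEigenvalue (A : E →ₗ[ℝ] E) μ := hasEigenvalue_of_hasEigenvector ⟨hmem, hv0⟩
  have : eigenspace (A : E →ₗ[ℝ] E) ((⟨μ, hμ, hμ'⟩ : ↥{μ : ℝ | 1 ≤ |μ| ∧ HasEigenvalue ((A : E →L[ℝ] E) : E →ₗ[ℝ] E) μ}) : ℝ) ≤ (⨆ μ : ↥{μ : ℝ | 1 ≤ |μ| ∧ HasEigenvalue ((A : E →L[ℝ] E) : E →ₗ[ℝ] E) μ}, eigenspace ((A : E →L[ℝ] E) : E →ₗ[ℝ] E) (μ : ℝ)) :=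
    le_iSup (fun ν : ↥{μ : ℝ | 1 ≤ |μ| ∧ HasEigenvalue ((A : E →L[ℝ] E) : E →ₗ[ℝ] E) μ} => eigenspace (A : E →ₗ[ℝ] E) (ν : ℝ)) ⟨μ, hμ, hμ'⟩
  exact this hmem

omit [CompleteSpace E] in
/-- `(⨆ μ : ↥{μ : ℝ | 1 ≤ |μ| ∧ HasEigenvalue ((A : E →L[ℝ] E) : E →ₗ[ℝ] E) μ}, eigenspace ((A : E →L[ℝ] E) : E →ₗ[ℝ] E) (μ : ℝ))` is invariant under `A`. -/
theorem bigSpace_invariant : ∀ v ∈ (⨆ μ : ↥{μ : ℝ | 1 ≤ |μ| ∧ HasEigenvalue ((A : E →L[ℝ] E) : E →ₗ[ℝ] E) μ}, eigenspace ((A : E →L[ℝ] E) : E →ₗ[ℝ] E) (μ : ℝ)), A v ∈ (⨆ μ : ↥{μ : ℝ | 1 ≤ |μ| ∧ HasEigenvalue ((A : E →L[ℝ] E) : E →ₗ[ℝ] E) μ}, eigenspace ((A : E →L[ℝ] E) : E →ₗ[ℝ] E) (μ : ℝ)) := by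
  intro v hv
  refine Submodule.iSup_induction (fun μ : ↥{μ : ℝ | 1 ≤ |μ| ∧ HasEigenvalue ((A : E →L[ℝ] E) : E →ₗ[ℝ] E) μ} => eigenspace (A : E →ₗ[ℝ] E) (μ : ℝ))
    (motive := fun v => A v ∈ (⨆ μ : ↥{μ : ℝ | 1 ≤ |μ| ∧ HasEigenvalue ((A : E →L[ℝ] E) : E →ₗ[ℝ] E) μ}, eigenspace ((A : E →L[ℝ] E) : E →ₗ[ℝ] E) (μ : ℝ))) hv ?_ ?_ ?_
  · intro μ x hx
    have hAx : A x = (μ : ℝ) • x := mem_eigenspace_iff.1 hx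
    rw [hAx]
    exact Submodule.smul_mem _ _ ((le_iSup (fun ν : ↥{μ : ℝ | 1 ≤ |μ| ∧ HasEigenvalue ((A : E →L[ℝ] E) : E →ₗ[ℝ] E) μ} => eigenspace (A : E →ₗ[ℝ] E) (ν : ℝ)) μ) hx)
  · rw [map_zero]; exact Submodule.zero_mem _
  · intro x y hx hy
    rw [map_add]; exact Submodule.add_mem _ hx hy

/-- The orthogonal complement of `(⨆ μ : ↥{μ : ℝ | 1 ≤ |μ| ∧ HasEigenvalue ((A : E →L[ℝ] E) : E →ₗ[ℝ] E) μ}, eigenspace ((A : E →L[ℝ] E) : E →ₗ[ℝ] E) (μ : ℝ))` is invariant under a self-adjoint `A`. -/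
theorem bigSpace_orthogonal_invariant (hsa : IsSelfAdjoint A) :
    ∀ w ∈ (⨆ μ : ↥{μ : ℝ | 1 ≤ |μ| ∧ HasEigenvalue ((A : E →L[ℝ] E) : E →ₗ[ℝ] E) μ}, eigenspace ((A : E →L[ℝ] E) : E →ₗ[ℝ] E) (μ : ℝ))ᗮ, A w ∈ (⨆ μ : ↥{μ : ℝ | 1 ≤ |μ| ∧ HasEigenvalue ((A : E →L[ℝ] E) : E →ₗ[ℝ] E) μ}, eigenspace ((A : E →L[ℝ] E) : E →ₗ[ℝ] E) (μ : ℝ))ᗮ := by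
  intro w hw
  rw [Submodule.mem_orthogonal] at hw ⊢
  intro u hu
  have hsym : (A : E →ₗ[ℝ] E).IsSymmetric := hsa.isSymmetric
  have : ⟪u, A w⟫_ℝ = ⟪A u, w⟫_ℝ := (hsym u w).symm
  rw [this]
  exact hw (A u) (bigSpace_invariant u hu)

omit [CompleteSpace E] in
/-- No eigenvector of modulus `≥ 1` survives in `(⨆ μ : ↥{μ : ℝ | 1 ≤ |μ| ∧ HasEigenvalue ((A : E →L[ℝ] E) : E →ₗ[ℝ] E) μ}, eigenspace ((A : E →L[ℝ] E) : E →ₗ[ℝ] E) (μ : ℝ))ᗮ`. -/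
theorem eq_zero_of_eigen_mem_orthogonal {v : E} {μ : ℝ} (hv : A v = μ • v) (hμ : 1 ≤ |μ|)
    (hw : v ∈ (⨆ μ : ↥{μ : ℝ | 1 ≤ |μ| ∧ HasEigenvalue ((A : E →L[ℝ] E) : E →ₗ[ℝ] E) μ}, eigenspace ((A : E →L[ℝ] E) : E →ₗ[ℝ] E) (μ : ℝ))ᗮ) : v = 0 := by
  have h1 : v ∈ (⨆ μ : ↥{μ : ℝ | 1 ≤ |μ| ∧ HasEigenvalue ((A : E →L[ℝ] E) : E →ₗ[ℝ] E) μ}, eigenspace ((A : E →L[ℝ] E) : E →ₗ[ℝ] E) (μ : ℝ)) := mem_bigSpace_of_eigen hv hμ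
  have : ⟪v, v⟫_ℝ = 0 := (Submodule.mem_orthogonal _ _).1 hw v h1
  exact inner_self_eq_zero.1 this

/-! ## 4. Strict contraction on the orthogonal complement -/

/-- **Contraction off the big spectral subspace.** There is `ρ < 1` with `‖A w‖ ≤ ρ ‖w‖` on `(⨆ μ : ↥{μ : ℝ | 1 ≤ |μ| ∧ HasEigenvalue ((A : E →L[ℝ] E) : E →ₗ[ℝ] E) μ}, eigenspace ((A : E →L[ℝ] E) : E →ₗ[ℝ] E) (μ : ℝ))ᗮ`
(norm attainment for the compact self-adjoint restriction). -/
theorem exists_contraction_orthogonal (hsa : IsSelfAdjoint A) (hk : IsCompactOperator A) :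
    ∃ ρ : ℝ, 0 ≤ ρ ∧ ρ < 1 ∧ ∀ w ∈ (⨆ μ : ↥{μ : ℝ | 1 ≤ |μ| ∧ HasEigenvalue ((A : E →L[ℝ] E) : E →ₗ[ℝ] E) μ}, eigenspace ((A : E →L[ℝ] E) : E →ₗ[ℝ] E) (μ : ℝ))ᗮ, ‖A w‖ ≤ ρ * ‖w‖ := by
  set G : Submodule ℝ E := (⨆ μ : ↥{μ : ℝ | 1 ≤ |μ| ∧ HasEigenvalue ((A : E →L[ℝ] E) : E →ₗ[ℝ] E) μ}, eigenspace ((A : E →L[ℝ] E) : E →ₗ[ℝ] E) (μ : ℝ))ᗮ with hG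
  have hinv : ∀ w ∈ G, A w ∈ G := bigSpace_orthogonal_invariant hsa
  set AG : G →L[ℝ] G := A.restrict hinv with hAG
  have hAGapp : ∀ w : G, ((AG w : G) : E) = A w := fun w => rfl
  refine ⟨‖AG‖, norm_nonneg AG, ?_, ?_⟩
  · by_contra hge
    push Not at hge
    have hAGne : AG ≠ 0 := by
      intro h
      have h0 : ‖AG‖ = 0 := by rw [h]; exact ContinuousLinearMap.opNorm_zero
      linarith
    have hsym : (A : E →ₗ[ℝ] E).IsSymmetric := hsa.isSymmetric
    have hsymG : (AG : G →ₗ[ℝ] G).IsSymmetric := by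
      rw [hAG, ContinuousLinearMap.toLinearMap_restrict]
      exact hsym.restrict_invariant hinv
    have hsaG : IsSelfAdjoint AG := ContinuousLinearMap.isSelfAdjoint_iff_isSymmetric.2 hsymG
    have hkG : IsCompactOperator AG := by
      have := hk.restrict' (V := G) hinv
      rw [hAG]
      exact this
    obtain ⟨v, hv0, hv⟩ := exists_eigenvector_norm_or_neg AG hsaG hkG hAGne
    have hvE : (v : E) ≠ 0 := fun h => hv0 (Subtype.ext h)
    rcases hv with h | h
    · have hAv : A (v : E) = ‖AG‖ • (v : E) := by
        rw [← hAGapp, h]; rfl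
      exact hvE (eq_zero_of_eigen_mem_orthogonal hAv (by rwa [abs_of_nonneg (norm_nonneg AG)]) v.2)
    · have hAv : A (v : E) = (-‖AG‖) • (v : E) := by
        rw [← hAGapp, h]; rfl
      exact hvE (eq_zero_of_eigen_mem_orthogonal hAv
        (by rwa [abs_neg, abs_of_nonneg (norm_nonneg AG)]) v.2)
  · intro w hw
    have := AG.le_opNorm ⟨w, hw⟩
    rwa [Submodule.coe_norm, Submodule.coe_norm, hAGapp] at this

end Summit.RiemannHypothesis.RiemannHypothesis.Theorems.SuzukiDoorTailWitness

end
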